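import Summits.QuantumFields.YangMills.Theorems.UnitScaleTiltProp7QTwCentralSectorRegPr
import HarnessLib

/-!
# Route `UnitScaleTilt`, crux K1 child «MinimiserStabilityRegPr» (stmt-QuantumFields-19200), stub `stub_existenceMinimalOrbit` (EX), lane II (B4★)∕(QB) «⊕ central» summand —
# **THE COMB CHART MAPS THE CENTRE INTO THE CENTRE**: `QTw U₀ (c·1) e ∈ ℂ·1` for every complex scalar bond field `c`, every coarse bond `e`, at the flat member unconditionally and at every
# printed-regular background (`RegPr F n K ε₀ U₀`, `10⁷L³ε₀ ≤ 1`) — the second half of the traceless ⊕ central DECOUPLING of the (QB) quadratic forms (px19 g6 LOCATE v2 §3: «ONE lemma per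
# operator … map central to central»), for the averaging operator `QTw`.

Cell `ym3-torus`, width seat `ym3-torus-px10` (gen 5).  `--supports stmt-QuantumFields-19200 --as helper`; THEOREMS ONLY (0 `def`, 0 `sorry`); count-neutral; nothing here claims the
stub, the crux, d = 4 or the mass gap — YM₃ on T³ is a ladder rung (R3), not the Clay problem.

MECHANISM (no explicit formula needed).  By ✓`Prop7QTwCentralSector.dbarTw_central_one` the twisted double-bar variable of the central perturbation `(iz)·1` at `U₀ = 1` is an EMBEDDED SCALAR
unit `ι w`, so the chart value `log U̿^{tw}_1((iz)·1)(e) = log(ι w)` COMMUTES WITH EVERY MATRIX (`log` is a power series in its argument: lit ✓`B7BlockAvgLog.commute_mlog_right` — no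
smallness needed); along the real line `t ↦ (t·ir)·1` the chart values therefore commute with every `M` for small `t` (the scalar clauses of ✓`Prop7QTwCentralScalarField.scalarClauses_small`),
hence so does their derivative `QTw 1 ((ir)·1) e` (the commutator `[f(t), M]` vanishes identically near `0`, so its derivative `[f′(0), M]` vanishes); a `2 × 2` matrix commuting with every
matrix unit is scalar (Mathlib `Matrix.mem_range_scalar_of_commute_single`); complex `c` by ℂ-linearity; curved `U₀` by ✓`QTw_smul_one_apply_eq_QTw_one_of_regPr`.

WHAT IS PROVED:
* `commute_logChartTw_one_central` (chart values of central perturbations at `U₀ = 1` commute with everything, under the scalar clauses), `commute_QTw_one_apply_of_eventually_commute`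
  (if the chart values along a real line commute with `M` near `0`, so does `QTw 1 V e`: the commutator map is a continuous ℂ-linear map killing the curve, hence its derivative),
  ★`commute_QTw_one_smulI_one` (`QTw 1 ((ir)·1) e` commutes with every `M`, `r` real — clauses discharged by ✓`scalarClauses_small`), ★★`exists_QTw_one_smul_one_eq_smul_one`
  (`∃ s, QTw 1 (c·1) e = s·1`, every complex `c`), ★★★`exists_QTw_smul_one_eq_smul_one_of_regPr` (the same at `RegPr F n K ε₀ U₀`, `10⁷L³ε₀ ≤ 1`).
HONEST SCOPE.  Calculus + by-name assembly; nothing of (QB)∕(ENG)∕(REC)∕`hN06`∕the crux is advanced by this file alone; nothing of print is asserted.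

References: T. Bałaban, CMP **99** (1985) 389–434 [Balaban1985BackgroundPropagators] ((3.13)–(3.15) p.393); CMP **98** (1985) 17–51 [Balaban1985Averaging] ((21) p.22, (89)–(92) p.31);
CMP **95** (1984) 17–40 [Balaban1984PropagatorsI] ((1.18) p.20); CMP **102** (1985) 277–309 [Balaban1985Variational] ((44) p.285, (51) p.286).
-/

set_option autoImplicit false

noncomputable section

open scoped Matrix.Norms.L2Operator Topology

namespace Summit.QuantumFields.YangMills.Theorems.Prop7QTwCentralValued

open NormedSpace Filter
open Literature.MathematicalPhysics.QuantumFieldTheory.Balaban1983to89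
open T4Continuum BlockAveraging MatrixLog
open T3ContinuumYM3Torus
open T3LevelShift (bondShift)
open T3PrintedRegularOrbits (sites_eq)
open T3PrintedRegularMinimiser (RegPr)
open B7Prop1Explicit (expUnit)
open B7Eq99Concrete (wrec)
open B7BlockAvgLog (commute_mlog_right)
open B10Eq27TorusAxialLog (pull)
open Summit.QuantumFields.YangMills.Theorems.Prop7SPrint (basePt)
open Summit.QuantumFields.YangMills.Theorems.Prop8Chart (emlIterU)
open Summit.QuantumFields.YangMills.Theorems.Prop7SymAvgTw (coordT3 logChartTw QTw logChartTw_apply QTw_def)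
open Summit.QuantumFields.YangMills.Theorems.Prop7SymAvgTwSym (commute_algebraMap)
open Summit.QuantumFields.YangMills.Theorems.Prop7QTwFlatExplicit (differentiableAt_logChartTw_one)
open Summit.QuantumFields.YangMills.Theorems.Prop7QTwCentralSector (dbarTw_central_one)
open Summit.QuantumFields.YangMills.Theorems.Prop7QTwCentralScalarField (scalarClauses_small)
open Summit.QuantumFields.YangMills.Theorems.Prop7QTwCentralSectorRegPr (QTw_smul_one_apply_eq_QTw_one_of_regPr)

/-! ## The comb chart maps the centre into the centre -/

section T3

variable (F : T3Family) {n K : ℕ} (h : n ≤ K)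

/-- **CHART VALUES OF CENTRAL PERTURBATIONS AT `U₀ = 1` COMMUTE WITH EVERYTHING**: under the scalar clauses of ✓`dbarTw_central_one`, `log U̿^{tw}_1((iz)·1)(e) = log(ι w)` for an embedded
scalar unit `ι w`, and a power series in a central element is central (lit ✓`commute_mlog_right`). [cite: Balaban1985Averaging, (21) p.22, (89)-(92) p.31; Balaban1985BackgroundPropagators, (3.13) p.393] -/
theorem commute_logChartTw_one_central (z : PBond (F.P K) 0 → ℂ)
    (hφZ : ∀ j, j < K - n → ∀ (q : B7Prop1Explicit.Site (F.P K).d) (κ : Fin (F.P K).d) (r : Fin (F.P K).d → Fin (F.P K).L),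
      ‖((B7Prop1Explicit.Wcx (F.P K).L (B7Prop2Explicit.avgIter (F.P K).L (pull (fun b => expUnit (Complex.I * z b)) (basePt F n K)) j) q κ (B7Prop1Explicit.boxVec (F.P K).L r) : ℂˣ) : ℂ) - 1‖ ≤ 1 / 8)
    (hw : ∀ j, j < K - n → ∀ (w : B7Prop1Explicit.Site (F.P K).d) (r : Fin (F.P K).d → Fin (F.P K).L),
      ‖((((wrec (F.P K).L 1 (pull (fun b => expUnit (Complex.I * z b)) (basePt F n K)) j (((F.P K).L : ℤ) • w))⁻¹ *
          (B7Prop1Explicit.hol (B7Prop2Explicit.avgIter (F.P K).L (pull (fun b => expUnit (Complex.I * z b)) (basePt F n K)) j) (((F.P K).L : ℤ) • w) (B7Prop1Explicit.treeWord (B7Prop1Explicit.boxVec (F.P K).L r)) *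
            wrec (F.P K).L 1 (pull (fun b => expUnit (Complex.I * z b)) (basePt F n K)) j (((F.P K).L : ℤ) • w + B7Prop1Explicit.boxVec (F.P K).L r)) : ℂˣ)) : ℂ) - 1‖ < 1)
    (hφT : ∀ j, j < K - n → ∀ (c : PBond (F.P K) (j + 1)) (i : Idx (F.P K)), ‖((Prop8Chart.loopHolU (emlIterU j (fun b => expUnit (Complex.I * z b))) c i : ℂˣ) : ℂ) - 1‖ ≤ 1 / 8)
    (e : PBond (F.P n) 0) (M : Matrix (Fin 2) (Fin 2) ℂ) :
    Commute (logChartTw F n K h 1 (fun b => (Complex.I * z b) • (1 : Matrix (Fin 2) (Fin 2) ℂ)) e) M := by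
  rw [logChartTw_apply, dbarTw_central_one F h z hφZ hw hφT e, Units.coe_map, MonoidHom.coe_coe]
  exact (commute_mlog_right (commute_algebraMap (𝔸 := Matrix (Fin 2) (Fin 2) ℂ) _ M).symm).symm

/-- **IF THE CHART VALUES ALONG A REAL LINE COMMUTE WITH `M` NEAR `0`, SO DOES `QTw 1 V`**: the commutator map `Φ_M : X ↦ (e ↦ X e·M − M·X e)` is ℂ-linear (continuous: finite dimension),
`Φ_M ∘ log U̿^{tw}_1 ∘ (t ↦ t•V)` vanishes identically near `0`, and its derivative there is `Φ_M (QTw 1 V)` (✓`differentiableAt_logChartTw_one`, the ℂ-Fréchet derivative read along the real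
line) — so `Φ_M (QTw 1 V) = 0`. [cite: Balaban1985BackgroundPropagators, (3.14) p.393] -/
theorem commute_QTw_one_apply_of_eventually_commute (V : PBond (F.P K) 0 → Matrix (Fin 2) (Fin 2) ℂ) (M : Matrix (Fin 2) (Fin 2) ℂ)
    (hc : ∀ᶠ t : ℝ in 𝓝 0, ∀ e : PBond (F.P n) 0, Commute (logChartTw F n K h 1 (t • V) e) M) (e : PBond (F.P n) 0) :
    Commute (QTw F n K h 1 V e) M := by
  -- the commutator with `M`, coordinatewise, as a continuous ℂ-linear map of the chart's codomain
  let Φₗ : (PBond (F.P n) 0 → Matrix (Fin 2) (Fin 2) ℂ) →ₗ[ℂ] (PBond (F.P n) 0 → Matrix (Fin 2) (Fin 2) ℂ) :=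
    { toFun := fun X e => X e * M - M * X e
      map_add' := fun X Y => by funext e; simp only [Pi.add_apply]; noncomm_ring
      map_smul' := fun a X => by funext e; simp only [Pi.smul_apply, RingHom.id_apply, smul_sub, Algebra.smul_mul_assoc, Algebra.mul_smul_comm] }
  let Φ : (PBond (F.P n) 0 → Matrix (Fin 2) (Fin 2) ℂ) →L[ℂ] (PBond (F.P n) 0 → Matrix (Fin 2) (Fin 2) ℂ) := LinearMap.toContinuousLinearMap Φₗ
  have hΦ : ∀ X (e : PBond (F.P n) 0), Φ X e = X e * M - M * X e := fun X e => rfl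
  -- the real line and the chart's derivative along it
  have hl : HasDerivAt (fun t : ℝ => t • V) V 0 := by
    simpa using (hasDerivAt_id (0 : ℝ)).smul_const V
  have h0 : (0 : PBond (F.P K) 0 → Matrix (Fin 2) (Fin 2) ℂ) = (0 : ℝ) • V := by rw [zero_smul]
  have hd := differentiableAt_logChartTw_one F h (n := n) (K := K)
  have h₁ := ((QTw_def (F := F) (n := n) (K := K) (h := h) 1 ▸ hd.hasFDerivAt).restrictScalars ℝ).comp_hasDerivAt_of_eq (0 : ℝ) hl h0
  have h₂ := (Φ.restrictScalars ℝ).hasFDerivAt.comp_hasDerivAt (0 : ℝ) h₁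
  -- the commutator vanishes identically near `0`
  have h₃ : (⇑(Φ.restrictScalars ℝ) ∘ (logChartTw F n K h 1 ∘ fun t : ℝ => t • V)) =ᶠ[𝓝 (0 : ℝ)] fun _ => (0 : PBond (F.P n) 0 → Matrix (Fin 2) (Fin 2) ℂ) := by
    filter_upwards [hc] with t ht
    funext e'
    show Φ (logChartTw F n K h 1 (t • V)) e' = 0
    rw [hΦ, (ht e').eq, sub_self]
  have h₄ : HasDerivAt (⇑(Φ.restrictScalars ℝ) ∘ (logChartTw F n K h 1 ∘ fun t : ℝ => t • V)) (0 : PBond (F.P n) 0 → Matrix (Fin 2) (Fin 2) ℂ) 0 :=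
    (hasDerivAt_const (0 : ℝ) (0 : PBond (F.P n) 0 → Matrix (Fin 2) (Fin 2) ℂ)).congr_of_eventuallyEq h₃
  have h₅ := h₂.unique h₄
  have h₆ : Φ (QTw F n K h 1 V) = 0 := by simpa using h₅
  have h₇ := congr_fun h₆ e
  rw [hΦ, Pi.zero_apply, sub_eq_zero] at h₇
  exact h₇

/-- ★ **`QTw 1 ((ir)·1) e` COMMUTES WITH EVERY MATRIX** (`r` real): along `t ↦ (t·ir)·1` the chart values commute with `M` for `|t| < δ(r)` (✓`scalarClauses_small` ⇒ the clauses of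
`commute_logChartTw_one_central` at `z := t·r`). [cite: Balaban1985BackgroundPropagators, (3.14)-(3.15) p.393; Balaban1984PropagatorsI, (1.18) p.20] -/
theorem commute_QTw_one_smulI_one (r : PBond (F.P K) 0 → ℝ) (e : PBond (F.P n) 0) (M : Matrix (Fin 2) (Fin 2) ℂ) :
    Commute (QTw F n K h 1 (fun b => (Complex.I * (r b : ℂ)) • (1 : Matrix (Fin 2) (Fin 2) ℂ)) e) M := by
  obtain ⟨δ, hδ0, hδ⟩ := scalarClauses_small F (n := n) (K := K) r
  refine commute_QTw_one_apply_of_eventually_commute F h _ M ?_ e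
  have hball : Metric.ball (0 : ℝ) δ ∈ 𝓝 (0 : ℝ) := Metric.ball_mem_nhds 0 hδ0
  filter_upwards [hball] with t ht
  rw [Metric.mem_ball, dist_zero_right, Real.norm_eq_abs] at ht
  obtain ⟨hφZ, hw, hφT⟩ := hδ t ht
  have hline : (t • fun b => (Complex.I * (r b : ℂ)) • (1 : Matrix (Fin 2) (Fin 2) ℂ)) = fun b => (Complex.I * (((t * r b : ℝ)) : ℂ)) • (1 : Matrix (Fin 2) (Fin 2) ℂ) := by
    funext b
    rw [Pi.smul_apply, ← Complex.coe_smul, smul_smul, Complex.ofReal_mul]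
    ring_nf
  rw [hline]
  intro e'
  exact commute_logChartTw_one_central F h (fun b => (((t * r b : ℝ)) : ℂ)) hφZ hw hφT e' M

/-- ★★ **`QTw 1 (c·1) e ∈ ℂ·1` FOR EVERY COMPLEX SCALAR FIELD `c`**: `c·1 = (−i)·((i·Re c)·1) + (i·Im c)·1`, ℂ-linearity of `QTw 1`, the two summands commute with every matrix (§2 ★), and a
matrix commuting with every matrix unit is scalar (Mathlib `Matrix.mem_range_scalar_of_commute_single`). [cite: Balaban1984PropagatorsI, (1.18) p.20; Balaban1985Variational, (51) p.286] -/
theorem exists_QTw_one_smul_one_eq_smul_one (c : PBond (F.P K) 0 → ℂ) (e : PBond (F.P n) 0) :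
    ∃ s : ℂ, QTw F n K h 1 (fun b => c b • (1 : Matrix (Fin 2) (Fin 2) ℂ)) e = s • (1 : Matrix (Fin 2) (Fin 2) ℂ) := by
  have hsplit : (fun b => c b • (1 : Matrix (Fin 2) (Fin 2) ℂ)) =
      (-Complex.I) • (fun b => (Complex.I * ((c b).re : ℂ)) • (1 : Matrix (Fin 2) (Fin 2) ℂ)) + (fun b => (Complex.I * ((c b).im : ℂ)) • (1 : Matrix (Fin 2) (Fin 2) ℂ)) := by
    funext b
    simp only [Pi.add_apply, Pi.smul_apply, smul_smul, ← add_smul]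
    congr 1
    rw [← Complex.re_add_im (c b)]
    simp only [Complex.add_re, Complex.add_im, Complex.ofReal_re, Complex.ofReal_im, Complex.mul_re, Complex.mul_im, Complex.I_re, Complex.I_im]
    ring_nf
    rw [Complex.I_sq]
    ring
  have hcomm : ∀ M : Matrix (Fin 2) (Fin 2) ℂ, Commute (QTw F n K h 1 (fun b => c b • (1 : Matrix (Fin 2) (Fin 2) ℂ)) e) M := by
    intro M
    rw [hsplit, map_add, map_smul, Pi.add_apply, Pi.smul_apply]
    exact ((commute_QTw_one_smulI_one F h (fun b => (c b).re) e M).smul_left _).add_left (commute_QTw_one_smulI_one F h (fun b => (c b).im) e M)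
  obtain ⟨s, hs⟩ := Matrix.mem_range_scalar_of_commute_single (M := QTw F n K h 1 (fun b => c b • (1 : Matrix (Fin 2) (Fin 2) ℂ)) e) fun i j _ => (hcomm _).symm
  refine ⟨s, ?_⟩
  rw [← hs, Matrix.scalar_apply, Matrix.smul_one_eq_diagonal]

/-- ★★★ **`QTw U₀ (c·1) e ∈ ℂ·1` AT EVERY PRINTED-REGULAR BACKGROUND** (`RegPr F n K ε₀ U₀`, `10⁷L³ε₀ ≤ 1`): the comb averaging operator maps the centre into the centre — by
✓`QTw_smul_one_apply_eq_QTw_one_of_regPr` and the flat case. [cite: Balaban1985BackgroundPropagators, (3.14)-(3.15) p.393; Balaban1984PropagatorsI, (1.18) p.20; Balaban1985Variational, (51) p.286] -/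
theorem exists_QTw_smul_one_eq_smul_one_of_regPr {ε₀ : ℝ} (hε₀ : 0 < ε₀) (hε : 10 ^ 7 * (F.L : ℝ) ^ 3 * ε₀ ≤ 1)
    (U₀ : GaugeField (F.P K) 0 (Matrix.specialUnitaryGroup (Fin 2) ℂ)) (hreg : RegPr F n K ε₀ U₀) (c : PBond (F.P K) 0 → ℂ) (e : PBond (F.P n) 0) :
    ∃ s : ℂ, QTw F n K h U₀ (fun b => c b • (1 : Matrix (Fin 2) (Fin 2) ℂ)) e = s • (1 : Matrix (Fin 2) (Fin 2) ℂ) := by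
  rw [QTw_smul_one_apply_eq_QTw_one_of_regPr F h hε₀ hε U₀ hreg c e]
  exact exists_QTw_one_smul_one_eq_smul_one F h c e

end T3

end Summit.QuantumFields.YangMills.Theorems.Prop7QTwCentralValued

end
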